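import Summits.Ventures.LatticeQCDFlow.Scaling.FlowGraphConjugacy

/-!
HONEST FRAMING: exact (Metropolis-corrected) sampling algorithms for lattice gauge theory; figures
of merit are autocorrelation/cost numbers at stated couplings and volumes; no continuum-physics
claim.

# FlowCompleteGraph — ALL-PAIRS EXCHANGE THROUGH COMPOSED FLOWS IS QUADRATIC IN THE NUMBER OF REPLICAS, TWO-SIDED:
# ON THE COMPLETE SWAP GRAPH (`2m = K(K+1)`) WITH CONSISTENT MAPS `φ_{(i,l)} = L_l⁻¹∘L_i` (`L_0 = id`), HOT-ONLY UPDATES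
# AND TRANSPORTED DOMINATION, `p·min{t/(3K(K+1)), γ₀(1−t)/(14K)} ≤ Gap ≤ 2t·min{μ_0(A),μ_0(Aᶜ)}/(K(K+1)·v)`
# (lean-2 GEN-23, ours)

Venture-side (OURS).  Cell `lqcd-flow` (pub-lqcd), unit `pub-lqcd-lean-2-g23`, 2026-08-27.  Chapter K, file 19: the
named corollary of `Scaling/FlowGraphConjugacy` (K8) and `Scaling/SwapGraphDilution` (K1) for the design "propose any
two replicas uniformly and exchange them through the composition of the trained maps between them".

## What is proved

* **`flowCompleteGraph_spectralGap_two_sided`** — simple edge list with `2m = K(K+1)` entries containing the hub,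
  consistent maps from level bijections `L` with `L_0 = id`, hot-only updates, hot Poincaré constant `γ₀`, transported
  domination `p·μ_{k+1}(L_{k+1}⁻¹u) ≤ μ_0(u)`, a set `A` with `μ_k(L_k⁻¹A)μ_k(L_k⁻¹Aᶜ) ≥ v > 0` at the cold levels:
  **`p·min{t/(3K(K+1)), γ₀(1−t)/(14K)} ≤ Gap(P^φ) ≤ 2t·min{μ_0(A), μ_0(Aᶜ)}/(K(K+1)·v)`**.

Reading (no numerics implied): perfect composed transports (`p = 1`) do not rescue all-pairs exchange from its
quadratic law; the hub with the same maps is linear (`Scaling/FlowHubProposalLaw`).  NOT CLAIMED: inconsistent maps;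
continuous spaces; anything measured.  Literature grade (cell rule): OWN COMPOSITION; nothing cited as a fact; no new
bib keys.
-/

noncomputable section

open Finset Function
open Literature.Probability.MarkovChains

namespace Summit.Ventures.LatticeQCDFlow.Scaling

variable {S : Type*} [Fintype S] [DecidableEq S] {K m : ℕ} {μ : Fin (K + 1) → S → ℝ}
  {M : Fin (K + 1) → S → S → ℝ} {t : ℝ} {e : Fin m → Fin (K + 1) × Fin (K + 1)}

/-- **ALL-PAIRS EXCHANGE THROUGH COMPOSED FLOWS IS ORDER `K⁻²`, TWO-SIDED.** [ours] -/
theorem flowCompleteGraph_spectralGap_two_sided [Nontrivial S] (L : Fin (K + 1) → Equiv.Perm S)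
    (hL0 : L 0 = Equiv.refl S) (hK : 1 ≤ K) (hm2 : 2 * m = K * (K + 1)) (he : ∀ r, (e r).1 ≠ (e r).2)
    (hsimple : Function.Injective (fun r => ({(e r).1, (e r).2} : Finset (Fin (K + 1)))))
    (hhub : ∀ k : Fin K, ∃ j, e j = ((0 : Fin (K + 1)), k.succ)) (hμ : ∀ k x, 0 < μ k x)
    (hμ1 : ∀ k, ∑ u, μ k u = 1) (hM : ∀ k, IsRowStochastic (M k)) (hMrev : ∀ k, DetailedBalance (μ k) (M k))
    (ht0 : 0 < t) (ht1 : t < 1) {p γ₀ : ℝ} (hp : 0 < p) (hp1 : p ≤ 1) (hγ₀ : 0 < γ₀)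
    (hdom : ∀ (k : Fin K) (u : S), p * μ k.succ ((L k.succ).symm u) ≤ μ 0 u)
    (hgap0 : ∀ g : S → ℝ, γ₀ * lawVariance (μ 0) g ≤ dirichletForm (μ 0) (M 0) g) {A : Finset S} {v : ℝ}
    (hvpos : 0 < v)
    (hv : ∀ k : Fin (K + 1), k ≠ 0 → v ≤ (∑ u ∈ A, μ k ((L k).symm u)) * ∑ u ∈ Aᶜ, μ k ((L k).symm u)) :
    p * min (t / (3 * (K * (K + 1)))) (γ₀ * (1 - t) / (14 * K))
        ≤ spectralGap (tensorFun μ) (fun x y : Fin (K + 1) → S =>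
            t * ptGraphSwap μ e (fun r => (L (e r).1).trans (L (e r).2).symm) x y
              + (1 - t) * prodKernel (fun k : Fin (K + 1) => if k = 0 then (1 : ℝ) else 0) M x y)
      ∧ spectralGap (tensorFun μ) (fun x y : Fin (K + 1) → S =>
            t * ptGraphSwap μ e (fun r => (L (e r).1).trans (L (e r).2).symm) x y
              + (1 - t) * prodKernel (fun k : Fin (K + 1) => if k = 0 then (1 : ℝ) else 0) M x y)
          ≤ 2 * t * min (∑ u ∈ A, μ 0 u) (∑ u ∈ Aᶜ, μ 0 u) / (K * (K + 1) * v) := by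
  rw [flowGraph_spectralGap_eq L he t]
  have hL0u : ∀ u, (L 0).symm u = u := fun u => by rw [hL0]; rfl
  have hν0 : (fun u => μ 0 ((L 0).symm u)) = μ 0 := funext fun u => by rw [hL0u]
  have hM0 : (fun u v => M 0 ((L 0).symm u) ((L 0).symm v)) = M 0 := funext fun u => funext fun v => by rw [hL0u, hL0u]
  have h := completeGraph_spectralGap_two_sided (μ := fun i u => μ i ((L i).symm u))
    (M := fun i u v => M i ((L i).symm u) ((L i).symm v)) (e := e) hK hm2 he hsimple hhub (fun k u => hμ k _)
    (fun k => by rw [Equiv.sum_comp (L k).symm (μ k)]; exact hμ1 k)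
    (fun k => ⟨fun u v => (hM k).1 _ _, fun u => by
      simpa using (Equiv.sum_comp (L k).symm (fun v => M k ((L k).symm u) v)).trans ((hM k).2 _)⟩)
    (fun k u v => hMrev k _ _) ht0 ht1 hp hp1 hγ₀ (fun k u => by simp only [hL0u]; exact hdom k u)
    (fun g => by
      have e1 : lawVariance (fun u => μ 0 ((L 0).symm u)) g = lawVariance (μ 0) g := by rw [hν0]
      have e2 : dirichletForm (fun u => μ 0 ((L 0).symm u)) (fun u v => M 0 ((L 0).symm u) ((L 0).symm v)) g
          = dirichletForm (μ 0) (M 0) g := by rw [hν0, hM0]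
      rw [e1, e2]; exact hgap0 g)
    (A := A) hvpos hv
  simp only [hL0u] at h
  exact h

end Summit.Ventures.LatticeQCDFlow.Scaling

end
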